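import Summits.QuantumFields.YangMills.Theorems.UnitScaleTiltProp7TorusGreenGradientDecay
import HarnessLib

/-!
# Route `UnitScaleTilt`, crux K1 «MinimiserStabilityRegPr» (stmt-QuantumFields-19200), route-R E′ path (α′), residue (hK), far-field fork (A3), row (R2): THE ZERO-MODE-REMOVED
# BIHARMONIC TORUS GREEN FUNCTION `G̃₂(z) = L^{-d} Σ_{k≠0} cos(p_k·z)∕ε(p_k)²` — HEAT-KERNEL REPRESENTATION WITH THE `s`-WEIGHT AND THE FOURIER TAIL OF ITS FIRST DIFFERENCE
# (d-GENERIC LETTERS; the `d = 3` bound `|G̃₂(z+eᵢ) − G̃₂(z)| ≤ C` is the sibling file `…TorusGreen2GradientBound`)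

Cell `ym3-torus`, width seat `ym3-torus-px13` (gen 2); ★routeR-w3 g5 NAMING 2026-08-28T19:28:35Z «px13: (R2) G̃₂ FIRST DIFFERENCE O(1)» (+ ★★OWNER g28 CONDUCT WORD 2; (R3) = the
second∕third differences, ★w8-19200 g7, reads the same spelled-out `G̃₂` and the same representation).  `--supports stmt-QuantumFields-19200`, count-neutral.  THEOREMS ONLY (0 `def`,
0 `sorry`): `G̃₂` is SPELLED OUT as the explicit Fourier sum — lit ✓ `LatticeGreenFunction.torusGreen`'s formula with `ε(p_k)²` for `ε(p_k)` — and never abbreviated.  YM₃ on T³ is a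
ladder rung (R3), not the Clay problem; nothing here claims the stub, the crux, d = 4 or the gap.

THE POINT.  `G̃₂ = 4·(−Δ)⁻²` (zero mode removed; `ε = Σ_μ(1 − cos p_μ)` is HALF the symbol of `−Δ`) is the biharmonic Green function whose differences the (A3) peeling `χ·∇_bG̃₂` of the
(hK) kernel needs pointwise (LOCATE 19200 evidence #53 §§10–11).  Mode by mode `1∕ε² = ∫₀^S s·e^{−sε} ds + e^{−Sε}(1 + Sε)∕ε²`, so — exactly as ✓ `torusGreen_eq_integral_add_tail` does for
`G̃₁` with `1∕ε = ∫₀^S e^{−sε}ds + e^{−Sε}∕ε` — `G̃₂(z) = ∫₀^S s·(∏_μ q^L_s(z_μ) − L^{−d}) ds + L^{−d}Σ_{k≠0} cos(p_k·z)·e^{−Sε_k}(1 + Sε_k)∕ε_k²`, and the first difference drops the constant: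
`G̃₂(z+eᵢ) − G̃₂(z) = ∫₀^S s·(∏_μ q^L_s((z+eᵢ)_μ) − ∏_μ q^L_s(z_μ)) ds + L^{−d}Σ_{k≠0} e^{−Sε_k}(1 + Sε_k)ε_k⁻²·Re[χ_k(z)(χ_k(eᵢ) − 1)]`.  At `S = L²` the tail is `≤ (π∕16)·C₁^d·L³∕L^d`
(`C₁ = Σ_{n∈ℤ} 2^{−|n|}`): ONE character factor `‖χ_k(eᵢ) − 1‖ ≤ ‖p̃_k‖_∞ ≤ (πL³∕32)·ε_k²` (Jordan `ε ≥ (2∕π²)‖p̃‖²_∞` twice and `‖p̃_k‖_∞ ≥ 2π∕L` for `k ≠ 0`) cancels the divisor `ε_k²`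
up to `L³`, `(1 + x)e^{−x} ≤ 2e^{−x∕2}`, and `e^{−L²ε_k∕2} ≤ ∏_μ e^{−4k̃_μ²} ≤ ∏_μ 2^{−|k̃_μ|}` is summable over the centred momenta.  In `d = 3` this tail is `O(1)` — L-UNIFORM, which is
all (R2) needs (the heat-kernel part is `O(1)` by (R1)'s small-distance letter, sibling file).

WHAT IS PROVED (ns `…Theorems.Prop7TorusGreen2HeatKernel`; carrier `TorusSite d L = Fin d → ZMod L`; all `d`, all `L ≥ 1`).
* §1 `integral_mul_exp_neg_mul_eq` — `∫₀^S s·e^{−sε} ds = (1 − e^{−Sε}(1 + Sε))∕ε²` (`ε ≠ 0`).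
* §2 ★★ `torusGreen2_eq_integral_add_tail` — the representation of `G̃₂` displayed above (any `S`); ★★ `torusGreen2_grad_eq` — the representation of `G̃₂(z+eᵢ) − G̃₂(z)`.
* §3 `norm_single_sub_one_le_dispersion_sq` — `‖χ_k(eᵢ) − 1‖ ≤ (πL³∕32)·ε(p_k)²` for `k ≠ 0`; `add_one_mul_exp_neg_le` — `(1+x)e^{−x} ≤ 2e^{−x∕2}` (`x ≥ 0`);
  `exp_neg_half_sq_mul_dispersion_le` — `e^{−L²ε_k∕2} ≤ ∏_μ e^{−4k̃_μ²}`; `exp_neg_four_mul_sq_le` — `e^{−4n²} ≤ 2^{−|n|}`;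
  ★★ `abs_torusGreen2_grad_tail_le` — `|L^{−d}Σ_{k≠0} e^{−L²ε_k}(1 + L²ε_k)ε_k⁻²·Re[χ_k(z)(χ_k(eᵢ) − 1)]| ≤ (π∕16)·C₁^d·L³∕L^d`.
HONEST SCOPE.  Representation + tail only (Literature-grade lattice letters placed in the Summits lineage that consumes them, like ✓p659194); the `d = 3` gradient bound is the sibling file;
the reading on `Tor (fine ℓ M)`∕`Site (F.P K) 0` (`LapSinv ∘ LapSinv`) is row (R5), not here.

References: G. F. Lawler, V. Limic, *Random Walk: A Modern Introduction*, CUP 2010, Ch. 4, §6.3 [LawlerLimic2010]; T. Bałaban, CMP 96 (1984) 223–250 [Balaban1984PropagatorsII]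
((1.9) p.226); CMP 99 (1985) 75–102 [Balaban1985RegularSpaces] ((1.36) p.82).
-/

set_option autoImplicit false

noncomputable section

open MeasureTheory Set Finset ZMod intervalIntegral
open scoped Real BigOperators ComplexConjugate

namespace Summit.QuantumFields.YangMills.Theorems.Prop7TorusGreen2HeatKernel

open Literature.Probability.LatticeModels
open Prop7TorusGreenGradientDecay (norm_single_sub_one_le_dispersion)

variable {d L : ℕ} [NeZero L]

/-! ## §1 The `s`-weighted exponential integral -/

omit [NeZero L] in
/-- **`∫₀^S s·e^{−sε} ds = (1 − e^{−Sε}(1 + Sε))∕ε²`** for `ε ≠ 0` (the antiderivative is `−(s∕ε + 1∕ε²)·e^{−sε}`). [folklore] -/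
theorem integral_mul_exp_neg_mul_eq {ε : ℝ} (hε : ε ≠ 0) (S : ℝ) :
    ∫ s in (0 : ℝ)..S, s * Real.exp (-(s * ε)) = (1 - Real.exp (-(S * ε)) * (1 + S * ε)) / ε ^ 2 := by
  have hderiv : ∀ s ∈ Set.uIcc (0 : ℝ) S,
      HasDerivAt (fun s : ℝ => -(s / ε + 1 / ε ^ 2) * Real.exp (-(s * ε))) (s * Real.exp (-(s * ε))) s := by
    intro s _
    have h1 : HasDerivAt (fun s : ℝ => -(s / ε + 1 / ε ^ 2)) (-(1 / ε)) s :=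
      (((hasDerivAt_id s).div_const ε).add_const (1 / ε ^ 2)).neg
    have h2 : HasDerivAt (fun s : ℝ => Real.exp (-(s * ε))) (Real.exp (-(s * ε)) * (-ε)) s := by
      have := ((hasDerivAt_id s).mul_const ε).neg.exp
      simpa using this
    have h := h1.mul h2
    have e : -(1 / ε) * Real.exp (-(s * ε)) + -(s / ε + 1 / ε ^ 2) * (Real.exp (-(s * ε)) * -ε) = s * Real.exp (-(s * ε)) := by
      field_simp
      ring
    rw [e] at h
    exact h
  have hint : IntervalIntegrable (fun s : ℝ => s * Real.exp (-(s * ε))) volume 0 S :=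
    (Continuous.intervalIntegrable (by fun_prop) _ _)
  rw [intervalIntegral.integral_eq_sub_of_hasDerivAt hderiv hint]
  simp only [zero_div, zero_add, zero_mul, neg_zero, Real.exp_zero, mul_one]
  field_simp
  ring

/-! ## §2 ★★ The heat-kernel representation of `G̃₂` and of its first difference -/

omit [NeZero L] in
/-- `p_0 = 0`. [folklore] -/
private theorem latticeMomentum_zero₂ (L : ℕ) : latticeMomentum L (0 : TorusSite d L) = 0 := by
  funext i; simp [latticeMomentum]

/-- `ε(0) = 0`. [folklore] -/
private theorem dispersion_zero₂ : dispersion (0 : Fin d → ℝ) = 0 := by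
  simp [dispersion]

/-- ★★ **Heat-kernel representation of `G̃₂` with the `s`-weight and a tail**: for every `S`,
`L^{-d} Σ_{k≠0} cos(p_k·z)∕ε(p_k)² = ∫₀^S s·(∏_μ q^L_s(z_μ) − L^{-d}) ds + L^{-d} Σ_{k≠0} cos(p_k·z)·e^{−Sε(p_k)}(1 + Sε(p_k))∕ε(p_k)²`
(mode by mode `1∕ε² = ∫₀^S s·e^{−sε}ds + e^{−Sε}(1+Sε)∕ε²`; the `k = 0` mode of the heat kernel is the constant `L^{-d}`). [folklore] -/
theorem torusGreen2_eq_integral_add_tail (z : TorusSite d L) (S : ℝ) :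
    (∑ k ∈ (univ : Finset (TorusSite d L)).erase 0,
        Real.cos (∑ i, latticeMomentum L k i * ((z i).val : ℝ)) / dispersion (latticeMomentum L k) ^ 2) / (L : ℝ) ^ d =
      (∫ s in (0 : ℝ)..S, s * (∏ i, torusHeatKernel s (z i) - ((L : ℝ) ^ d)⁻¹)) +
      (∑ k ∈ (univ : Finset (TorusSite d L)).erase 0,
        Real.cos (∑ i, latticeMomentum L k i * ((z i).val : ℝ)) *
          (Real.exp (-(S * dispersion (latticeMomentum L k))) * (1 + S * dispersion (latticeMomentum L k)) /
            dispersion (latticeMomentum L k) ^ 2)) / (L : ℝ) ^ d := by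
  classical
  have hLd : (0 : ℝ) < (L : ℝ) ^ d := by
    have : (0 : ℝ) < L := by exact_mod_cast Nat.pos_of_ne_zero (NeZero.ne L)
    positivity
  -- the integrand, mode by mode
  have hP : ∀ s : ℝ, s * (∏ i, torusHeatKernel s (z i) - ((L : ℝ) ^ d)⁻¹) =
      (∑ k ∈ (univ : Finset (TorusSite d L)).erase 0,
        Real.cos (∑ i, latticeMomentum L k i * ((z i).val : ℝ)) *
          (s * Real.exp (-(s * dispersion (latticeMomentum L k))))) / (L : ℝ) ^ d := by
    intro s
    rw [prod_torusHeatKernel_eq_sum, ← Finset.sum_erase_add _ _ (Finset.mem_univ (0 : TorusSite d L)),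
      latticeMomentum_zero₂, dispersion_zero₂]
    simp only [Pi.zero_apply, zero_mul, Finset.sum_const_zero, Real.cos_zero, mul_zero, neg_zero,
      Real.exp_zero, mul_one]
    rw [add_div, one_div, add_sub_cancel_right, mul_div_assoc', Finset.mul_sum]
    congr 1
    refine Finset.sum_congr rfl fun k _ => ?_
    ring
  simp_rw [hP]
  rw [intervalIntegral.integral_div, intervalIntegral.integral_finsetSum (fun k _ =>
    (Continuous.intervalIntegrable (by fun_prop) _ _)), ← add_div, ← Finset.sum_add_distrib]
  congr 1
  refine Finset.sum_congr rfl fun k hk => ?_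
  have hk0 : k ≠ 0 := Finset.ne_of_mem_erase hk
  have hεk : dispersion (latticeMomentum L k) ≠ 0 := (dispersion_latticeMomentum_pos hk0).ne'
  rw [intervalIntegral.integral_const_mul, integral_mul_exp_neg_mul_eq hεk]
  field_simp
  ring

/-- ★★ **The first difference of `G̃₂`, heat-kernel part plus Fourier tail**: for every `S`,
`G̃₂(z+eᵢ) − G̃₂(z) = ∫₀^S s·(∏_μ q^L_s((z+eᵢ)_μ) − ∏_μ q^L_s(z_μ)) ds + L^{-d} Σ_{k≠0} e^{−Sε_k}(1 + Sε_k)ε_k⁻²·Re[χ_k(z)(χ_k(eᵢ) − 1)]`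
(the constant `L^{-d}` drops out of the difference; `cos(p_k·y) = Re χ_k(y)`, `χ_k(z+eᵢ) = χ_k(z)χ_k(eᵢ)`). [folklore] -/
theorem torusGreen2_grad_eq (z : TorusSite d L) (i : Fin d) (S : ℝ) :
    (∑ k ∈ (univ : Finset (TorusSite d L)).erase 0,
        Real.cos (∑ μ, latticeMomentum L k μ * (((z + Pi.single i 1 : TorusSite d L) μ).val : ℝ)) / dispersion (latticeMomentum L k) ^ 2) / (L : ℝ) ^ d -
    (∑ k ∈ (univ : Finset (TorusSite d L)).erase 0,
        Real.cos (∑ μ, latticeMomentum L k μ * ((z μ).val : ℝ)) / dispersion (latticeMomentum L k) ^ 2) / (L : ℝ) ^ d =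
      (∫ s in (0 : ℝ)..S, s * ((∏ μ, torusHeatKernel s ((z + Pi.single i 1 : TorusSite d L) μ)) - ∏ μ, torusHeatKernel s (z μ))) +
      (∑ k ∈ (univ : Finset (TorusSite d L)).erase 0,
        Real.exp (-(S * dispersion (latticeMomentum L k))) * (1 + S * dispersion (latticeMomentum L k)) /
            dispersion (latticeMomentum L k) ^ 2 *
          (torusChar k z * (torusChar k (Pi.single i 1) - 1)).re) / (L : ℝ) ^ d := by
  have hI : ∀ y : TorusSite d L, IntervalIntegrable
      (fun s : ℝ => s * (∏ μ, torusHeatKernel s (y μ) - ((L : ℝ) ^ d)⁻¹)) volume 0 S := fun y =>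
    (continuous_id.mul ((continuous_prod_torusHeatKernel y).sub continuous_const)).intervalIntegrable _ _
  rw [torusGreen2_eq_integral_add_tail (z + Pi.single i 1) S, torusGreen2_eq_integral_add_tail z S]
  have hint : (∫ s in (0 : ℝ)..S, s * ((∏ μ, torusHeatKernel s ((z + Pi.single i 1 : TorusSite d L) μ)) - ∏ μ, torusHeatKernel s (z μ))) =
      (∫ s in (0 : ℝ)..S, s * (∏ μ, torusHeatKernel s ((z + Pi.single i 1 : TorusSite d L) μ) - ((L : ℝ) ^ d)⁻¹)) -
      (∫ s in (0 : ℝ)..S, s * (∏ μ, torusHeatKernel s (z μ) - ((L : ℝ) ^ d)⁻¹)) := by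
    rw [← intervalIntegral.integral_sub (hI _) (hI _)]
    congr 1
    funext s
    ring
  rw [hint]
  -- the tails
  have htail : ∀ k : TorusSite d L,
      Real.cos (∑ μ, latticeMomentum L k μ * (((z + Pi.single i 1 : TorusSite d L) μ).val : ℝ)) *
          (Real.exp (-(S * dispersion (latticeMomentum L k))) * (1 + S * dispersion (latticeMomentum L k)) /
            dispersion (latticeMomentum L k) ^ 2) -
        Real.cos (∑ μ, latticeMomentum L k μ * ((z μ).val : ℝ)) *
          (Real.exp (-(S * dispersion (latticeMomentum L k))) * (1 + S * dispersion (latticeMomentum L k)) /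
            dispersion (latticeMomentum L k) ^ 2) =
      Real.exp (-(S * dispersion (latticeMomentum L k))) * (1 + S * dispersion (latticeMomentum L k)) /
          dispersion (latticeMomentum L k) ^ 2 *
        (torusChar k z * (torusChar k (Pi.single i 1) - 1)).re := by
    intro k
    rw [← torusChar_re, ← torusChar_re, torusChar_add_right]
    simp only [Complex.sub_re, Complex.mul_re, Complex.one_re, Complex.one_im, Complex.sub_im]
    ring
  rw [← Finset.sum_congr rfl fun k _ => htail k, Finset.sum_sub_distrib]
  ring

/-! ## §3 ★★ The Fourier tail of the first difference at `S = L²` -/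

/-- **One character factor against the SQUARED dispersion**: for `k ≠ 0`, `‖χ_k(eᵢ) − 1‖ ≤ (πL³∕32)·ε(p_k)²` (`‖χ_k(eᵢ) − 1‖ ≤ ‖p̃_k‖_∞`, `ε ≥ (2∕π²)‖p̃_k‖²_∞` on the Brillouin zone,
and `‖p̃_k‖_∞ ≥ 2π∕L` for `k ≠ 0`, so `‖p̃‖ = ‖p̃‖⁴∕‖p̃‖³ ≤ (π⁴∕4)ε²·L³∕(8π³)`). [folklore] -/
theorem norm_single_sub_one_le_dispersion_sq (k : TorusSite d L) (hk : k ≠ 0) (i : Fin d) :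
    ‖torusChar k (Pi.single i 1) - 1‖ ≤ π * (L : ℝ) ^ 3 / 32 * dispersion (latticeMomentum L k) ^ 2 := by
  have hL : (0 : ℝ) < L := by exact_mod_cast Nat.pos_of_ne_zero (NeZero.ne L)
  set p : Fin d → ℝ := fun μ => 2 * π * ((k μ).valMinAbs : ℝ) / L with hp
  have hi : ‖torusChar k (Pi.single i 1) - 1‖ ≤ ‖p‖ := by
    rw [torusChar_single_eq_stdAddChar]
    exact (norm_stdAddChar_sub_one_le (k i)).trans (le_of_eq_of_le (Real.norm_eq_abs _).symm (norm_le_pi_norm p i))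
  have hε := mul_norm_sq_le_dispersion (centredMomentum_mem_brillouin k)
  rw [← dispersion_latticeMomentum_eq_centred] at hε
  -- `‖p‖ ≥ 2π/L` for `k ≠ 0`
  obtain ⟨μ₁, hμ₁⟩ : ∃ μ, k μ ≠ 0 := by
    by_contra h
    push Not at h
    exact hk (funext h)
  have h1 : (1 : ℝ) ≤ |((k μ₁).valMinAbs : ℝ)| := by
    have h0 : (k μ₁).valMinAbs ≠ 0 := fun h => hμ₁ ((ZMod.valMinAbs_eq_zero _).1 h)
    rw [← Int.cast_abs]; exact_mod_cast Int.one_le_abs h0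
  have hpμ : 2 * π / L ≤ ‖p‖ := by
    have hle : |p μ₁| ≤ ‖p‖ := le_of_eq_of_le (Real.norm_eq_abs _).symm (norm_le_pi_norm p μ₁)
    have e : |p μ₁| = 2 * π * |((k μ₁).valMinAbs : ℝ)| / L := by
      rw [hp]; simp only
      rw [abs_div, abs_mul, abs_mul, abs_two, abs_of_pos Real.pi_pos, Nat.abs_cast]
    rw [e] at hle
    have : 2 * π / L ≤ 2 * π * |((k μ₁).valMinAbs : ℝ)| / L := by
      rw [div_le_div_iff_of_pos_right hL]; nlinarith [Real.pi_pos]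
    exact this.trans hle
  have hp0 : 0 < ‖p‖ := lt_of_lt_of_le (by positivity) hpμ
  -- `‖p‖⁴ ≤ (π⁴/4)ε²` and `‖p‖³ ≥ (2π/L)³`
  have h4 : ‖p‖ ^ 4 ≤ π ^ 4 / 4 * dispersion (latticeMomentum L k) ^ 2 := by
    have h2 : 0 ≤ 2 / π ^ 2 * ‖p‖ ^ 2 := by positivity
    have := mul_le_mul hε hε h2 (dispersion_nonneg _)
    have e : 2 / π ^ 2 * ‖p‖ ^ 2 * (2 / π ^ 2 * ‖p‖ ^ 2) = 4 / π ^ 4 * ‖p‖ ^ 4 := by ring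
    rw [e] at this
    have hπ4 : (0 : ℝ) < π ^ 4 := by positivity
    calc ‖p‖ ^ 4 = π ^ 4 / 4 * (4 / π ^ 4 * ‖p‖ ^ 4) := by field_simp
      _ ≤ π ^ 4 / 4 * (dispersion (latticeMomentum L k) * dispersion (latticeMomentum L k)) := by gcongr
      _ = π ^ 4 / 4 * dispersion (latticeMomentum L k) ^ 2 := by ring
  have h3 : (2 * π / L) ^ 3 ≤ ‖p‖ ^ 3 := pow_le_pow_left₀ (by positivity) hpμ 3
  calc ‖torusChar k (Pi.single i 1) - 1‖ ≤ ‖p‖ := hi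
    _ = ‖p‖ ^ 4 / ‖p‖ ^ 3 := by field_simp
    _ ≤ (π ^ 4 / 4 * dispersion (latticeMomentum L k) ^ 2) / (2 * π / L) ^ 3 := by
        gcongr
    _ = π * (L : ℝ) ^ 3 / 32 * dispersion (latticeMomentum L k) ^ 2 := by
        field_simp
        ring

omit [NeZero L] in
/-- `(1 + x)·e^{−x} ≤ 2·e^{−x/2}` for `x ≥ 0` (`1 + x ≤ 2(1 + x∕2) ≤ 2e^{x∕2}`). [folklore] -/
theorem add_one_mul_exp_neg_le {x : ℝ} (hx : 0 ≤ x) : (1 + x) * Real.exp (-x) ≤ 2 * Real.exp (-(x / 2)) := by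
  have h1 : 1 + x ≤ 2 * Real.exp (x / 2) := by
    have := Real.add_one_le_exp (x / 2)
    linarith
  have e : Real.exp (-x) = Real.exp (-(x / 2)) * (Real.exp (x / 2))⁻¹ := by
    rw [← Real.exp_neg, ← Real.exp_add]; congr 1; ring
  rw [e]
  have hpos : 0 < Real.exp (x / 2) := Real.exp_pos _
  calc (1 + x) * (Real.exp (-(x / 2)) * (Real.exp (x / 2))⁻¹) = (1 + x) / Real.exp (x / 2) * Real.exp (-(x / 2)) := by
        field_simp
    _ ≤ 2 * Real.exp (-(x / 2)) := by
        gcongr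
        rw [div_le_iff₀ hpos]
        exact h1

/-- `e^{−L²ε(p_k)∕2} ≤ ∏_μ e^{−4k̃_μ²}` (Jordan: `1 − cos p̃_μ ≥ (2∕π²)p̃_μ² = 8k̃_μ²∕L²`). [folklore] -/
theorem exp_neg_half_sq_mul_dispersion_le (k : TorusSite d L) :
    Real.exp (-((L : ℝ) ^ 2 * dispersion (latticeMomentum L k) / 2)) ≤ ∏ μ, Real.exp (-(4 * ((k μ).valMinAbs : ℝ) ^ 2)) := by
  have h := exp_neg_sq_mul_dispersion_le k
  -- take square roots: `e^{-x/2} = √(e^{-x})`, `∏ e^{-4n²} = √(∏ e^{-8n²})`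
  have e1 : Real.exp (-((L : ℝ) ^ 2 * dispersion (latticeMomentum L k) / 2)) =
      Real.sqrt (Real.exp (-((L : ℝ) ^ 2 * dispersion (latticeMomentum L k)))) := by
    rw [Real.sqrt_eq_rpow, ← Real.exp_mul]; congr 1; ring
  have e2 : ∏ μ, Real.exp (-(4 * ((k μ).valMinAbs : ℝ) ^ 2)) = Real.sqrt (∏ μ, Real.exp (-(8 * ((k μ).valMinAbs : ℝ) ^ 2))) := by
    rw [← Real.exp_sum, ← Real.exp_sum, Real.sqrt_eq_rpow, ← Real.exp_mul, Finset.sum_mul]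
    congr 1
    refine Finset.sum_congr rfl fun μ _ => ?_
    ring
  rw [e1, e2]
  exact Real.sqrt_le_sqrt h

omit [NeZero L] in
/-- `e^{−4n²} ≤ 2^{−|n|}` on `ℤ` (from ✓ `exp_neg_eight_mul_sq_le` one would get `2^{−|n|∕2}`; directly: `4n² ≥ |n| ≥ |n|·log 2`). [folklore] -/
theorem exp_neg_four_mul_sq_le (n : ℤ) : Real.exp (-(4 * (n : ℝ) ^ 2)) ≤ (1 / 2 : ℝ) ^ n.natAbs := by
  have hN : ((n.natAbs : ℕ) : ℝ) = |(n : ℝ)| := by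
    rw [← Int.cast_abs, ← Int.natCast_natAbs]; rfl
  have h1 : Real.exp (-(4 * (n : ℝ) ^ 2)) ≤ Real.exp (-(n.natAbs : ℝ)) := by
    rw [Real.exp_le_exp, neg_le_neg_iff, hN]
    have hint : |(n : ℝ)| ≤ (n : ℝ) ^ 2 := by
      rw [← Int.cast_abs]
      have : |n| ≤ |n| ^ 2 := by
        rcases eq_or_ne n 0 with rfl | hn
        · simp
        · nlinarith [Int.one_le_abs hn]
      have h2 : ((|n| : ℤ) : ℝ) ≤ (((|n| ^ 2 : ℤ)) : ℝ) := by exact_mod_cast this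
      simpa [Int.cast_pow, Int.cast_abs, sq_abs] using h2
    nlinarith [abs_nonneg (n : ℝ)]
  refine h1.trans ?_
  rw [show -(n.natAbs : ℝ) = (n.natAbs : ℝ) * (-1) by ring, Real.exp_nat_mul]
  apply pow_le_pow_left₀ (Real.exp_pos _).le
  have h2 : (1 : ℝ) + 1 ≤ Real.exp 1 := Real.add_one_le_exp 1
  rw [Real.exp_neg, inv_le_comm₀ (Real.exp_pos _) (by norm_num)]
  norm_num
  linarith

/-- ★★ **The Fourier tail of the first difference of `G̃₂` is `O(L^{3−d})`**: with `C₁ = Σ_{n∈ℤ} 2^{−|n|}`, for all `z, i`,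
`|L^{-d} Σ_{k≠0} e^{−L²ε_k}(1 + L²ε_k)ε_k⁻²·Re[χ_k(z)(χ_k(eᵢ) − 1)]| ≤ (π∕16)·C₁^d·L³∕L^d` — `O(1)` in `d = 3`, uniformly in `L` and `z`. [folklore] -/
theorem abs_torusGreen2_grad_tail_le (z : TorusSite d L) (i : Fin d) :
    |(∑ k ∈ (univ : Finset (TorusSite d L)).erase 0,
        Real.exp (-((L : ℝ) ^ 2 * dispersion (latticeMomentum L k))) * (1 + (L : ℝ) ^ 2 * dispersion (latticeMomentum L k)) /
            dispersion (latticeMomentum L k) ^ 2 *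
          (torusChar k z * (torusChar k (Pi.single i 1) - 1)).re) / (L : ℝ) ^ d| ≤
      π / 16 * (∑' n : ℤ, (1 / 2 : ℝ) ^ n.natAbs) ^ d * (L : ℝ) ^ 3 / (L : ℝ) ^ d := by
  classical
  have hL : (0 : ℝ) < L := by exact_mod_cast Nat.pos_of_ne_zero (NeZero.ne L)
  have hLd : (0 : ℝ) < (L : ℝ) ^ d := by positivity
  rw [abs_div, abs_of_pos hLd, div_le_div_iff_of_pos_right hLd]
  have hterm : ∀ k ∈ (univ : Finset (TorusSite d L)).erase 0,
      |Real.exp (-((L : ℝ) ^ 2 * dispersion (latticeMomentum L k))) * (1 + (L : ℝ) ^ 2 * dispersion (latticeMomentum L k)) /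
            dispersion (latticeMomentum L k) ^ 2 *
          (torusChar k z * (torusChar k (Pi.single i 1) - 1)).re| ≤
        π * (L : ℝ) ^ 3 / 16 * ∏ μ, (1 / 2 : ℝ) ^ (k μ).valMinAbs.natAbs := by
    intro k hk
    have hk0 : k ≠ 0 := Finset.ne_of_mem_erase hk
    have hε := dispersion_latticeMomentum_pos hk0
    set x : ℝ := (L : ℝ) ^ 2 * dispersion (latticeMomentum L k) with hx
    have hx0 : 0 ≤ x := by positivity
    rw [abs_mul, abs_div, abs_mul, Real.abs_exp, abs_of_nonneg (by positivity : (0 : ℝ) ≤ 1 + x), abs_of_pos (by positivity)]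
    have hre : |(torusChar k z * (torusChar k (Pi.single i 1) - 1)).re| ≤ π * (L : ℝ) ^ 3 / 32 * dispersion (latticeMomentum L k) ^ 2 := by
      refine (Complex.abs_re_le_norm _).trans ?_
      rw [norm_mul, norm_torusChar, one_mul]
      exact norm_single_sub_one_le_dispersion_sq k hk0 i
    have hexp : Real.exp (-(x / 2)) ≤ ∏ μ, (1 / 2 : ℝ) ^ (k μ).valMinAbs.natAbs := by
      have h := exp_neg_half_sq_mul_dispersion_le k
      rw [show -((L : ℝ) ^ 2 * dispersion (latticeMomentum L k) / 2) = -(x / 2) by rw [hx]] at h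
      exact h.trans (Finset.prod_le_prod (fun μ _ => (Real.exp_pos _).le) fun μ _ => exp_neg_four_mul_sq_le _)
    calc Real.exp (-x) * (1 + x) / dispersion (latticeMomentum L k) ^ 2 * |(torusChar k z * (torusChar k (Pi.single i 1) - 1)).re|
        ≤ Real.exp (-x) * (1 + x) / dispersion (latticeMomentum L k) ^ 2 * (π * (L : ℝ) ^ 3 / 32 * dispersion (latticeMomentum L k) ^ 2) := by
          gcongr
      _ = π * (L : ℝ) ^ 3 / 32 * ((1 + x) * Real.exp (-x)) := by field_simp
      _ ≤ π * (L : ℝ) ^ 3 / 32 * (2 * Real.exp (-(x / 2))) := mul_le_mul_of_nonneg_left (add_one_mul_exp_neg_le hx0) (by positivity)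
      _ = π * (L : ℝ) ^ 3 / 16 * Real.exp (-(x / 2)) := by ring
      _ ≤ π * (L : ℝ) ^ 3 / 16 * ∏ μ, (1 / 2 : ℝ) ^ (k μ).valMinAbs.natAbs := by gcongr
  calc |∑ k ∈ (univ : Finset (TorusSite d L)).erase 0,
        Real.exp (-((L : ℝ) ^ 2 * dispersion (latticeMomentum L k))) * (1 + (L : ℝ) ^ 2 * dispersion (latticeMomentum L k)) /
            dispersion (latticeMomentum L k) ^ 2 *
          (torusChar k z * (torusChar k (Pi.single i 1) - 1)).re|
      ≤ ∑ k ∈ (univ : Finset (TorusSite d L)).erase 0, π * (L : ℝ) ^ 3 / 16 * ∏ μ, (1 / 2 : ℝ) ^ (k μ).valMinAbs.natAbs :=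
        (Finset.abs_sum_le_sum_abs _ _).trans (Finset.sum_le_sum hterm)
    _ ≤ ∑ k : TorusSite d L, π * (L : ℝ) ^ 3 / 16 * ∏ μ, (1 / 2 : ℝ) ^ (k μ).valMinAbs.natAbs :=
        Finset.sum_le_sum_of_subset_of_nonneg (Finset.erase_subset _ _) fun _ _ _ => by positivity
    _ = π * (L : ℝ) ^ 3 / 16 * (∑ κ : ZMod L, (1 / 2 : ℝ) ^ κ.valMinAbs.natAbs) ^ d := by
        rw [← Finset.mul_sum]
        congr 1
        rw [show (∑ κ : ZMod L, (1 / 2 : ℝ) ^ κ.valMinAbs.natAbs) ^ d = ∏ _μ : Fin d, ∑ κ : ZMod L, (1 / 2 : ℝ) ^ κ.valMinAbs.natAbs by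
          rw [Finset.prod_const, Finset.card_univ, Fintype.card_fin], Finset.prod_univ_sum]
        simp only [Fintype.piFinset_univ]
    _ ≤ π * (L : ℝ) ^ 3 / 16 * (∑' n : ℤ, (1 / 2 : ℝ) ^ n.natAbs) ^ d := by
        gcongr
        exact sum_half_pow_valMinAbs_le
    _ = π / 16 * (∑' n : ℤ, (1 / 2 : ℝ) ^ n.natAbs) ^ d * (L : ℝ) ^ 3 := by ring

end Summit.QuantumFields.YangMills.Theorems.Prop7TorusGreen2HeatKernel
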